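import Summits.ResolutionOfSingularities.ResolutionOfSingularities.Theorems.WildConesCampaignW46SurfacesMuDropIntertwiner

/-!
# [OURS · L1 W4.6, rung (i)] `CampaignW46HypersurfacesMuDrop p 2` for EVERY prime `p`: the Milnor
# number drops at EVERY forced step of a surface `z^p = a(u₁,u₂)` — no look-ahead, every field

Cell res-hironaka (LADDER-RESOLUTION rung L, D-0089), slot W4.6 «restricted regimes as rungs», seat
res-L1-s46-pv-2 (rung (i) SURFACES, second prover; strategy: embedded surface in 3-space over route
`WildCones`' point-blow-up dynamics, disjoint from res-L1-s46-pv-1's Hauser–Wagner invariant). Host: route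
`WildCones`, crux `ClassicalRegimes` (stmt-ResolutionOfSingularities-16884), `--supports … --as helper`.

HONEST FRAMING. Everything here is OURS; NOTHING is a statement of H. Hironaka's manuscript [Hironaka2017] and
nothing of it is used; no FACT-LIST premise (Huneke–Swanson's Lemma 14.3.4 enters only through the tree's
PROVED `Literature.AlgebraicGeometry.Resolution.PlaneChart.finrank_quotient_weakTransform_add_le`). AI review is
weaker than expert review.

## What is proved (and what was open)

`CampaignW46HypersurfacesMuDrop p n := ∀ κ [Field κ] [CharP κ p], WildCones.MuDrop p n κ` is the Eq. (127)-ROLE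
predicate of the W4.6 rungs (`Theorems/WildConesCampaignW46ThreefoldsCharTwoStatement.lean`, res-L1-type-o1): at
every step of the point-blow-up dynamics of `z^p = a(u₁,…,uₙ)` between two FORCED states (isolated of
multiplicity `p`), the Milnor number `μ = dim_κ κ⟦u⟧/(∂a)` drops strictly. It was PROVED at `p = 2` for every
`n` (res-L1-s46-pv-4, `muDrop_two`) and OPEN for odd `p` even at `n = 2`: the crux's colength engine
(`WildCones.stub_muDropSurfaceOrdSucc`, line `milnor-descent`) needs the successor to have cleaned order
`≥ p + 1` («high contact»; along an infinite run this is supplied by the NEXT step, whence only the look-ahead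
form `CampaignW46SurfacesMuDropLookahead` was available), because its Huneke–Swanson step
`dim R/J′ + dim R/𝔪ᵖ < dim R/J` requires an element of the gradient ideal `J` whose initial form is prime to the
chart variable `u_i` — and exactly at the last forced state before an order-`p` successor (`a_{p+1} =
β u_i² (u_j − τ u_i)^{p−1}`) no such element exists.

THIS FILE proves `campaignW46HypersurfacesMuDrop_surface (hp : p.Prime) : CampaignW46HypersurfacesMuDrop p 2`
— EVERY prime `p`, EVERY field of characteristic `p`, NO look-ahead — by removing the transversality hypothesis
(steps 1–3 are the helper files `Theorems/WildConesCampaignW46SurfacesMuDropShear.lean` and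
`Theorems/WildConesCampaignW46SurfacesMuDropIntertwiner.lean` of this seat; steps 4–5 are this file):

1. `finrank_quotient_weakTransform_add_le_intrinsic` — **`dim_κ R/J′ + dim_κ R/𝔪ʳ ≤ dim_κ R/J`** for ANY
   finite-colength `J ≤ 𝔪ʳ` of `R = κ⟦u_i,u_j⟧` containing an element with a non-zero degree-`r` coefficient
   (κ infinite), `J′` the weak transform at the point `t` of the `u_i`-chart. A generic SHEAR `u_i ↦ u_i − μ u_j`
   (`exists_generic_scalar`: the transversality functional `Σ f_l (−μ)^{r−l}` and `1 + μt` are non-zero for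
   some `μ` in an infinite field; `sum_coeff_shear_eq_zero`: the functional kills `(u_i + μ u_j)R + 𝔪ʳ⁺¹`) makes
   the sheared ideal `α(J)` transversal; route `FrobeniusClosing`'s chart-factorization core
   (`FactorizationProof.exists_intertwiner`, twice, + `eq_id_of_apply_chartMap`) yields an AUTOMORPHISM `ρ` with
   `σ_{i,t/(1+μt)} ∘ α = ρ ∘ σ_{i,t}` and `ρ(u_i) = u_i · unit` (`exists_shear_intertwiner`), so the weak transform
   of `α(J)` is `ρ(J′)`; colengths are invariant under `α`, `ρ`, and the tree's Huneke–Swanson lemma applies to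
   `α(J)`.
2. `finrank_quotient_span_sup_span_X_le_of_coeff_ne_zero` — the intersection number of `(∂_i T)` with the
   exceptional line is `≤ p + 1` WITHOUT high contact (its `u_i`-free slice is the Taylor expansion of the
   non-zero dehomogenised leading form of `a`, degree `≤ p + 1`; tree `PlaneChart.coeff_slice_eq_taylor`).
3. `add_two_le_finrank_quotient_maximalIdeal_pow` — `dim_κ R/𝔪ᵖ ≥ p + 2` for `p ≥ 3`.
4. `muDrop_of_forced_core` (`p ≥ 3`, perfect infinite field): structure lemma (`…CampaignW46Surfaces`: cleaned
   order exactly `p + 1`) + the crux's dictionary/chain rule (`WildCones.surfaceDict`) + right exactness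
   `μ(c′) ≤ dim R/((∂_i T) + (u_i)) + dim R/J′` + 1–3: `μ(c′) ≤ (p + 1) + μ(c) − (p + 2)`.
5. `muDrop_surface_of_perfect_infinite` (`p = 2` from res-L1-s46-pv-4's `muDrop_two`), then BASE CHANGE to an
   algebraic closure (route `JacobianBudget`'s kit via `CampaignW46.Surfaces.BaseChange`: `μ`, `Isol`, `MultP`
   invariant, `step` equivariant) gives the predicate over every field; corollaries
   `campaignW46Surfaces_forcedPrefix_lt_mu` / `campaignW46Surfaces_exists_exit_le_mu` sharpen the rung-(i)
   effective bound from `μ(c₀) + 1` to `μ(c₀)` forced states.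

References: C. Huneke, I. Swanson, *Integral Closure of Ideals, Rings, and Modules* (CUP 2006), Lemma 14.3.4
[HunekeSwanson2006] (through the tree's PlaneChart files); route files `Theses/WildCones.lean`, `Theses/FrobeniusClosing.lean`;
H. Hironaka, ms. 2017, Th. 16.6 (2) p.84 l.10–20 — quoted for the ROLE replaced only, under adjudication, not cited as fact.
-/

noncomputable section

-- single-problem summit: the doubled namespace component `ResolutionOfSingularities` is forced
set_option linter.dupNamespace false

noncomputable section

-- single-problem summit: the doubled namespace component `ResolutionOfSingularities` is forced
set_option linter.dupNamespace false

open scoped BigOperators Classical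
open MvPowerSeries IsLocalRing Finsupp Module
open Literature.RingTheory.MvPowerSeries.Jets Literature.RingTheory.Length
open Literature.AlgebraicGeometry.Resolution.PlaneChart

namespace Summit.ResolutionOfSingularities.ResolutionOfSingularities.Theorems

namespace CampaignW46.SurfacesMuDrop

open WildCones

variable {κ : Type} [Field κ]

/-! ## 4. The one-step Milnor drop on surfaces, `p ≥ 3`, perfect infinite field -/

section Core

open Summit.ResolutionOfSingularities.ResolutionOfSingularities.Theorems.FrobeniusClosing (chartSubst chartMap)
open Summit.ResolutionOfSingularities.ResolutionOfSingularities.Theorems.FrobeniusClosing.FactorizationProof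
  (hasSubst_chartSubst chartMap_X_self chartMap_X_of_ne)
open WildCones.MuDropSurface

/-- **A partial of a cleaned state with a degree-`(p+1)` monomial has a degree-`p` monomial.** For
`a = ser c` (no `p`-th-power monomials) with `coeff (p+1-l, l) a ≠ 0`, one of `∂_i a`, `∂_j a` has a
non-zero coefficient in degree `p` (if `p ∤ l` the `X j`-derivative sees it, if `p ∣ l` then
`p ∤ p + 1 - l` and the `X i`-derivative does). [folklore] -/
theorem exists_pd_coeff_ne_zero {p : ℕ} (hp : p.Prime) [CharP κ p] {i j : Fin 2} (hij : j ≠ i)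
    (c : (Fin 2 → ℕ) → κ) {l : ℕ} (hl : l ≤ p + 1)
    (hne : coeff (single i (p + 1 - l) + single j l) (ser p 2 κ c) ≠ 0) :
    ∃ (s : Fin 2) (l' : ℕ), l' ≤ p ∧
      coeff (single i (p - l') + single j l') (pd 2 κ s (ser p 2 κ c)) ≠ 0 := by
  haveI : Fact p.Prime := ⟨hp⟩
  -- the monomial `(p+1-l, l)` survives cleaning, so it is not a `p`-th power
  have hnot : ¬ (p ∣ (p + 1 - l) ∧ p ∣ l) := by
    rintro ⟨h1, h2⟩
    have h3 : p ∣ (p + 1 - l) + l := Nat.dvd_add h1 h2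
    rw [Nat.sub_add_cancel hl] at h3
    have : p ∣ 1 := (Nat.dvd_add_right (dvd_refl p)).mp h3
    exact hp.one_lt.ne' (Nat.dvd_one.mp this)
  by_cases hpl : p ∣ l
  · -- use `∂_i`: coefficient `(p + 1 - l) · a` at `(p - l, l)`
    have hndvd : ¬ p ∣ (p + 1 - l) := fun h => hnot ⟨h, hpl⟩
    have hlp : l ≤ p := by
      by_contra hcon
      have hl' : l = p + 1 := by omega
      rw [hl'] at hpl
      exact hp.one_lt.ne' (Nat.dvd_one.mp ((Nat.dvd_add_right (dvd_refl p)).mp hpl))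
    refine ⟨i, l, hlp, ?_⟩
    rw [MuDropSurface.coeff_pd]
    have he : (single i (p - l) + single j l : Fin 2 →₀ ℕ) + single i 1 = single i (p + 1 - l) + single j l := by
      rw [add_right_comm, ← single_add]; congr 2; omega
    rw [he, show ((single i (p - l) + single j l : Fin 2 →₀ ℕ) i + 1 : ℕ) = p + 1 - l by
      simp [hij.symm]; omega]
    refine mul_ne_zero ?_ hne
    intro h0
    exact hndvd ((CharP.cast_eq_zero_iff κ p _).mp h0)
  · -- use `∂_j`: coefficient `l · a` at `(p + 1 - l, l - 1)`
    have hl1 : 1 ≤ l := Nat.one_le_iff_ne_zero.mpr fun h => hpl (h ▸ dvd_zero p)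
    refine ⟨j, l - 1, by omega, ?_⟩
    rw [MuDropSurface.coeff_pd]
    have he : (single i (p - (l - 1)) + single j (l - 1) : Fin 2 →₀ ℕ) + single j 1 =
        single i (p + 1 - l) + single j l := by
      rw [add_assoc, ← single_add]; congr 2 <;> omega
    rw [he, show ((single i (p - (l - 1)) + single j (l - 1) : Fin 2 →₀ ℕ) j + 1 : ℕ) = l by
      simp [hij]; omega]
    refine mul_ne_zero ?_ hne
    intro h0
    exact hpl ((CharP.cast_eq_zero_iff κ p _).mp h0)

/-- [OURS · L1 W4.6 rung (i), core] **One-step Milnor drop on surfaces, `p ≥ 3`, no look-ahead**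
(perfect INFINITE field; the general field follows by base change). If a state `c` of `z^p = a(u₁,u₂)` and
its point-blow-up successor `c′ = step i τ c` are both forced (isolated of multiplicity `p`), then
`μ(c′) < μ(c)`. Proof: the structure lemma gives cleaned order exactly `p + 1` for `c`; with
`σ(a) = u_i^p T`, `J = (∂a)`, `J′ = (G_i, G_j)` its weak transform, `μ(c′) ≤ dim R/((∂_i T) + (u_i)) +
dim R/J′` (right exactness), `dim R/((∂_i T) + (u_i)) ≤ p + 1` (the slice of `∂_i T` is the Taylor
expansion of the non-zero dehomogenised leading form of `a`, of degree `≤ p + 1`), and the INTRINSIC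
Huneke–Swanson inequality `dim R/J′ + dim R/𝔪ᵖ ≤ dim R/J = μ(c)` (no transversality needed) with
`dim R/𝔪ᵖ ≥ p + 2` closes: `μ(c′) ≤ μ(c) - 1`. [folklore] -/
theorem muDrop_of_forced_core {p : ℕ} (hp : p.Prime) (hp3 : 3 ≤ p) [CharP κ p] [PerfectField κ] [Infinite κ]
    (c : (Fin 2 → ℕ) → κ) (i : Fin 2) (τ : Fin 2 → κ)
    (hI : Isol p 2 κ c) (hM : MultP p 2 κ c)
    (hI' : Isol p 2 κ (step p 2 κ i τ c)) (hM' : MultP p 2 κ (step p 2 κ i τ c)) :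
    mu p 2 κ (step p 2 κ i τ c) < mu p 2 κ c := by
  classical
  obtain ⟨j, hij⟩ : ∃ j : Fin 2, j ≠ i := ⟨i + 1, by fin_cases i <;> decide⟩
  -- structure of the forced regime
  have hO : ¬ OrdP p 2 κ c := Surfaces.not_ordP_of_forcedSuccessor hp c i τ hM hM'
  have hS : OrdPSucc p 2 κ c := Surfaces.ordPSucc_of_forcedSuccessor hp c i τ hM hI' hM'
  -- notation: `Θ = σ_{i,τ}` as an algebra hom
  let Θ : MvPowerSeries (Fin 2) κ →ₐ[κ] MvPowerSeries (Fin 2) κ := substAlgHom (hasSubst_chartSubst i τ)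
  have hΘ : ∀ f, Θ f = chartMap 2 κ i τ f := fun f => by
    change substAlgHom (hasSubst_chartSubst i τ) f = MvPowerSeries.subst (chartSubst 2 κ i τ) f
    rw [← coe_substAlgHom (hasSubst_chartSubst i τ)]
  have hΘi : Θ (X i) = X i := by rw [hΘ]; exact chartMap_X_self i τ
  have hΘj : Θ (X j) = X i * (X j + C (τ j)) := by rw [hΘ]; exact chartMap_X_of_ne i τ hij
  -- the dictionary and the chain rule
  obtain ⟨T, hdict, hpdT, hTj, hTi⟩ := surfaceDict p hp κ c i j hij τ hM
  -- orders
  have ham : ser p 2 κ c ∈ maximalIdeal _ ^ (p + 1) := ser_mem_pow_succ hM hO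
  have hpdm : ∀ l, pd 2 κ l (ser p 2 κ c) ∈ maximalIdeal _ ^ p := pd_mem_pow ham
  have hJm : jac p 2 κ c ≤ maximalIdeal _ ^ p := by
    rw [jac_eq_span_pair hij, Ideal.span_le]
    rintro _ (rfl | rfl)
    · exact hpdm i
    · exact hpdm j
  -- `σ(∂_l a) = X_i^p G_l`
  have hXi0 : (X i : MvPowerSeries (Fin 2) κ) ≠ 0 := X_ne_zero' i
  have hXip0 : (X i : MvPowerSeries (Fin 2) κ) ^ p ≠ 0 := pow_ne_zero _ hXi0
  obtain ⟨Gi, hGi⟩ := X_pow_dvd_of_mem_maximalIdeal_pow hij (τ j) Θ hΘi hΘj (hpdm i)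
  obtain ⟨Gj, hGj⟩ := X_pow_dvd_of_mem_maximalIdeal_pow hij (τ j) Θ hΘi hΘj (hpdm j)
  rw [hΘ] at hGi hGj
  -- `∂_j T = X_i G_j`, `∂_i T = G_i + (X_j + τ_j) G_j`
  have hpdTj : pd 2 κ j T = X i * Gj := by
    apply mul_left_cancel₀ hXip0
    rw [hTj, hGj]; ring
  have hpdTi : pd 2 κ i T = Gi + Gj * (X j + C (τ j)) := by
    apply mul_left_cancel₀ hXip0
    rw [hTi, hGi, hGj]; ring
  -- the two gradient ideals and the weak transform
  set J' : Ideal (MvPowerSeries (Fin 2) κ) := Ideal.span {Gi, Gj} with hJ'def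
  set K : Ideal (MvPowerSeries (Fin 2) κ) := Ideal.span {pd 2 κ i T} with hKdef
  have hjac' : jac p 2 κ (step p 2 κ i τ c) = K ⊔ Ideal.span {X i * Gj} := by
    rw [jac_eq_span_pair hij, hpdT i, hpdT j, hpdTj, hKdef, Ideal.span_insert]
  have hKG : K ⊔ Ideal.span {Gj} = J' := by
    rw [hKdef, hJ'def, ← Ideal.span_insert]
    apply le_antisymm
    · rw [Ideal.span_le, Set.insert_subset_iff, Set.singleton_subset_iff]
      refine ⟨?_, Ideal.subset_span (by simp)⟩
      rw [SetLike.mem_coe, hpdTi]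
      exact Ideal.add_mem _ (Ideal.subset_span (by simp))
        (Ideal.mul_mem_right _ _ (Ideal.subset_span (by simp)))
    · rw [Ideal.span_le, Set.insert_subset_iff, Set.singleton_subset_iff]
      refine ⟨?_, Ideal.subset_span (by simp)⟩
      have hGi' : Gi = pd 2 κ i T - Gj * (X j + C (τ j)) := by rw [hpdTi]; ring
      rw [SetLike.mem_coe, hGi']
      exact Ideal.sub_mem _ (Ideal.subset_span (by simp))
        (Ideal.mul_mem_right _ _ (Ideal.subset_span (by simp)))
  have hJ' : (jac p 2 κ c).map (Θ : MvPowerSeries (Fin 2) κ →+* MvPowerSeries (Fin 2) κ) =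
      Ideal.span {(X i : MvPowerSeries (Fin 2) κ) ^ p} * J' := by
    rw [jac_eq_span_pair hij, Ideal.map_span, Set.image_pair, hJ'def, Ideal.span_mul_span',
      Set.singleton_mul, Set.image_pair]
    change Ideal.span {Θ (pd 2 κ i (ser p 2 κ c)), Θ (pd 2 κ j (ser p 2 κ c))} = _
    rw [hΘ, hΘ, hGi, hGj]
  -- finiteness
  haveI hfinJ : Module.Finite κ (MvPowerSeries (Fin 2) κ ⧸ jac p 2 κ c) := hI
  have hjac'_le : jac p 2 κ (step p 2 κ i τ c) ≤ J' := by
    rw [hjac', ← hKG]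
    refine sup_le le_sup_left ?_
    rw [Ideal.span_singleton_le_iff_mem]
    exact Ideal.mem_sup_right (Ideal.mem_span_singleton'.mpr ⟨X i, by ring⟩)
  haveI hfin' : Module.Finite κ (MvPowerSeries (Fin 2) κ ⧸ jac p 2 κ (step p 2 κ i τ c)) := hI'
  haveI hfinJ' : Module.Finite κ (MvPowerSeries (Fin 2) κ ⧸ J') := finite_quotient_of_le (κ := κ) hjac'_le
  -- the leading form of `a` is non-zero in degree `p + 1`
  have hne : ∃ l, l ≤ p + 1 ∧ coeff (single i (p + 1 - l) + single j l) (ser p 2 κ c) ≠ 0 := by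
    obtain ⟨A, hA, hsum⟩ := hS
    let e : Fin 2 →₀ ℕ := Finsupp.equivFunOnFinite.symm A
    have he : (⇑e : Fin 2 → ℕ) = A := by simp [e]
    have hdeg : e i + e j = p + 1 := by
      rw [← hsum, ← he, sum_eq_degree, degree_eq_add hij]
    refine ⟨e j, by omega, ?_⟩
    have hexp : (single i (p + 1 - e j) + single j (e j) : Fin 2 →₀ ℕ) = e := by
      ext l
      rcases OrdPExitSurface.eq_or_eq i j hij l with rfl | rfl
      · simp [hij]; omega
      · simp [hij.symm]
    rw [coeff_ser, hexp, he]
    exact hA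
  have hTdict : Θ (ser p 2 κ c) = X i ^ p * T := by rw [hΘ]; exact hdict
  -- (A) the slice bound `dim R/((∂_i T) + (X i)) ≤ p + 1` — no high contact needed
  have hr : finrank κ (MvPowerSeries (Fin 2) κ ⧸ (K ⊔ Ideal.span {(X i : MvPowerSeries (Fin 2) κ)})) ≤ p + 1 := by
    -- the dehomogenised leading form `P` and its Taylor expansion at `τ j`
    set P : Polynomial κ := ∑ l ∈ Finset.range (p + 1 + 1),
      Polynomial.C (coeff (single i (p + 1 - l) + single j l) (ser p 2 κ c)) * Polynomial.X ^ l with hP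
    have hPcoeff : ∀ l, P.coeff l =
        if l < p + 1 + 1 then coeff (single i (p + 1 - l) + single j l) (ser p 2 κ c) else 0 := by
      intro l
      rw [hP, Polynomial.finsetSum_coeff]
      simp_rw [Polynomial.coeff_C_mul_X_pow]
      rw [Finset.sum_ite_eq (Finset.range (p + 1 + 1)) l]
      simp only [Finset.mem_range]
    have hP0 : P ≠ 0 := by
      obtain ⟨l, hl, hcl⟩ := hne
      intro h0
      have := hPcoeff l
      rw [h0, Polynomial.coeff_zero, if_pos (by omega)] at this
      exact hcl this.symm
    have hPdeg : P.natDegree ≤ p + 1 := by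
      rw [Polynomial.natDegree_le_iff_coeff_eq_zero]
      intro N hN
      rw [hPcoeff, if_neg]
      omega
    set Q := Polynomial.taylor (τ j) P with hQ
    have hQ0 : Q ≠ 0 := fun h => hP0 ((Polynomial.taylor_eq_zero (τ j) P).mp h)
    have hQdeg : Q.natDegree ≤ p + 1 := by rw [hQ, Polynomial.natDegree_taylor]; exact hPdeg
    have hslice : ∀ k, coeff (single j k) (pd 2 κ i T) = Q.coeff k := by
      intro k
      have h := MuDropSurface.coeff_pd i T (single j k)
      rw [show ((single j k : Fin 2 →₀ ℕ) i + 1 : ℕ) = 1 by simp [hij], Nat.cast_one, one_mul, add_comm] at h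
      rw [h, hQ]
      exact coeff_slice_eq_taylor hij (τ j) Θ hΘi hΘj ham hTdict k
    refine finrank_quotient_span_sup_span_X_le_of_coeff_ne_zero hij ⟨Q.natDegree, hQdeg, ?_⟩
    rw [hslice]
    exact Polynomial.leadingCoeff_ne_zero.mpr hQ0
  -- (B) a partial with a degree-`p` monomial and the intrinsic Huneke–Swanson inequality
  have hdrop : finrank κ (MvPowerSeries (Fin 2) κ ⧸ J') +
      finrank κ (MvPowerSeries (Fin 2) κ ⧸ maximalIdeal (MvPowerSeries (Fin 2) κ) ^ p) ≤
        finrank κ (MvPowerSeries (Fin 2) κ ⧸ jac p 2 κ c) := by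
    obtain ⟨l, hl, hcl⟩ := hne
    obtain ⟨s, l', hl', hsl⟩ := exists_pd_coeff_ne_zero hp hij c hl hcl
    have hsJ : pd 2 κ s (ser p 2 κ c) ∈ jac p 2 κ c := by
      rw [jac_eq_span_pair hij]
      rcases OrdPExitSurface.eq_or_eq i j hij s with rfl | rfl
      · exact Ideal.subset_span (by simp)
      · exact Ideal.subset_span (by simp)
    exact finrank_quotient_weakTransform_add_le_intrinsic hij (τ j) Θ hΘi hΘj hp.one_le hJm hsJ
      ⟨l', hl', hsl⟩ hJ'
  -- (C) `μ(c′) ≤ r + dim R/J'`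
  have hsub : finrank κ (MvPowerSeries (Fin 2) κ ⧸ (K ⊔ Ideal.span {X i * Gj})) ≤
      finrank κ (MvPowerSeries (Fin 2) κ ⧸ (K ⊔ Ideal.span {(X i : MvPowerSeries (Fin 2) κ)})) +
        finrank κ (MvPowerSeries (Fin 2) κ ⧸ (K ⊔ Ideal.span {Gj})) := by
    haveI : Module.Finite κ (MvPowerSeries (Fin 2) κ ⧸ (K ⊔ Ideal.span {X i * Gj})) := by
      rw [← hjac']; exact hI'
    exact finrank_quotient_sup_span_mul_le K (X i) Gj
  -- (D) `dim R/𝔪^p ≥ p + 2`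
  have hmp := add_two_le_finrank_quotient_maximalIdeal_pow (κ := κ) hij hp3
  -- assemble
  have hmu' : mu p 2 κ (step p 2 κ i τ c) =
      finrank κ (MvPowerSeries (Fin 2) κ ⧸ (K ⊔ Ideal.span {X i * Gj})) := by
    change finrank κ (MvPowerSeries (Fin 2) κ ⧸ jac p 2 κ (step p 2 κ i τ c)) = _
    rw [hjac']
  have hmu : mu p 2 κ c = finrank κ (MvPowerSeries (Fin 2) κ ⧸ jac p 2 κ c) := rfl
  rw [hKG] at hsub
  omega

end Core

/-! ## 5. Every field of characteristic `p`: base change, and the predicate BY NAME -/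

/-- [OURS · L1 W4.6 rung (i)] **`MuDrop p 2 κ` over a perfect infinite field, every prime `p`**
(`p = 2`: res-L1-s46-pv-4's `muDrop_two`; `p ≥ 3`: `muDrop_of_forced_core`). [folklore] -/
theorem muDrop_surface_of_perfect_infinite {p : ℕ} (hp : p.Prime) [CharP κ p] [PerfectField κ] [Infinite κ] :
    MuDrop p 2 κ := by
  intro c i τ hI hM hI' hM'
  by_cases h2 : p = 2
  · subst h2
    exact ThreefoldsCharTwo.muDrop_two 2 κ c i τ hI hM hI' hM'
  · have hp3 : 3 ≤ p := by
      rcases hp.eq_two_or_odd with h | h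
      · exact absurd h h2
      · have := hp.two_le; omega
    exact muDrop_of_forced_core hp hp3 c i τ hI hM hI' hM'

end CampaignW46.SurfacesMuDrop

/-! ## The rung-(i) Eq. (127)-role predicate WITHOUT look-ahead, for every prime `p` -/

section ByName

open WildCones CampaignW46.Surfaces.BaseChange CampaignW46.SurfacesMuDrop

/-- [OURS · L1 W4.6 rung (i), replaces the ROLE of Th. 16.6 (2) Eq. (127) p.84 l.10–20 for surfaces
`z^p = a(u₁,u₂)` with OUR invariant the Milnor number; NOT a statement of the manuscript]
**`CampaignW46HypersurfacesMuDrop p 2` for EVERY prime `p`, over EVERY field of characteristic `p`**: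
whenever a state of the point-blow-up dynamics of `z^p = a(u₁,u₂)` and its successor are both isolated of
multiplicity `p`, `μ` strictly drops — no look-ahead, no perfectness. (Base change to an algebraic closure:
`μ`, `Isol`, `MultP` are invariant and `step` is equivariant, route JacobianBudget's kit; there
`muDrop_surface_of_perfect_infinite`.) This closes, for `n = 2`, the instances left OPEN in
`Theorems/WildConesCampaignW46ThreefoldsCharTwoStatement.lean` («for odd `p` … covers `n ≤ 2` only» along
infinite runs) and upgrades `CampaignW46SurfacesMuDropLookahead`. [folklore] -/
theorem campaignW46HypersurfacesMuDrop_surface {p : ℕ} (hp : p.Prime) : CampaignW46HypersurfacesMuDrop p 2 := by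
  intro κ _ _ c i τ hI hM hI' hM'
  let L := AlgebraicClosure κ
  haveI : CharP L p := charP_of_injective_algebraMap (algebraMap κ L).injective p
  have hF := (forced_iff (L := L) c).mp ⟨hI, hM⟩
  have hF' := (forced_iff (L := L) (step p 2 κ i τ c)).mp ⟨hI', hM'⟩
  rw [step_eq] at hF'
  have key := muDrop_surface_of_perfect_infinite (κ := L) hp _ i _ hF.1 hF.2 hF'.1 hF'.2
  rw [mu_eq (L := L) c, mu_eq (L := L) (step p 2 κ i τ c), step_eq]
  exact key

/-- [OURS · L1 W4.6 rung (i)] The predicate for ALL primes at once (a single constant for the planner: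
`∀ p, p.Prime → CampaignW46HypersurfacesMuDrop p 2`). [folklore] -/
theorem campaignW46HypersurfacesMuDrop_surface_all : ∀ p : ℕ, p.Prime → CampaignW46HypersurfacesMuDrop p 2 :=
  fun _ hp => campaignW46HypersurfacesMuDrop_surface hp

/-- [OURS · L1 W4.6 rung (i); NOT a statement of the manuscript] **Sharpened effective bound**: over every
field of characteristic `p` (prime), a run of `z^p = a(u₁,u₂)` has at most `μ(c₀)` consecutive forced
states — if the states `0, …, M` are all forced then `M < μ(c₀)` (one better than
`CampaignW46SurfacesForcedExit`, thanks to the look-ahead-free drop). [folklore] -/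
theorem campaignW46Surfaces_forcedPrefix_lt_mu {p : ℕ} (hp : p.Prime) (κ : Type) [Field κ] [CharP κ p]
    (c₀ : (Fin 2 → ℕ) → κ) (i : ℕ → Fin 2) (t : ℕ → Fin 2 → κ) {M : ℕ}
    (hpre : ∀ m ≤ M, Isol p 2 κ (run p 2 κ c₀ i t m) ∧ MultP p 2 κ (run p 2 κ c₀ i t m)) :
    M < mu p 2 κ c₀ := by
  have hdrop := campaignW46HypersurfacesMuDrop_surface hp κ
  have hstep : ∀ m ≤ M, mu p 2 κ (run p 2 κ c₀ i t m) + m ≤ mu p 2 κ c₀ := by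
    intro m
    induction m with
    | zero => intro _; simp [run]
    | succ m ih =>
      intro hm
      have h1 : mu p 2 κ (run p 2 κ c₀ i t (m + 1)) < mu p 2 κ (run p 2 κ c₀ i t m) :=
        hdrop _ (i m) (t m) (hpre m (by omega)).1 (hpre m (by omega)).2
          (hpre (m + 1) hm).1 (hpre (m + 1) hm).2
      have := ih (by omega)
      omega
  have hM := hstep M le_rfl
  have hpos := CampaignW46.ThreefoldsCharTwo.mu_pos hp.two_le (hpre M le_rfl).1 (hpre M le_rfl).2
  omega

/-- [OURS · L1 W4.6 rung (i); NOT a statement of the manuscript] **Exit within `μ(c₀)` steps** on surfaces,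
every prime `p`, every field of characteristic `p`. [folklore] -/
theorem campaignW46Surfaces_exists_exit_le_mu {p : ℕ} (hp : p.Prime) (κ : Type) [Field κ] [CharP κ p]
    (c₀ : (Fin 2 → ℕ) → κ) (i : ℕ → Fin 2) (t : ℕ → Fin 2 → κ) :
    ∃ m ≤ mu p 2 κ c₀, ¬ (Isol p 2 κ (run p 2 κ c₀ i t m) ∧ MultP p 2 κ (run p 2 κ c₀ i t m)) := by
  by_contra h
  refine lt_irrefl _ (campaignW46Surfaces_forcedPrefix_lt_mu hp κ c₀ i t (M := mu p 2 κ c₀) fun m hm => ?_)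
  by_contra h'
  exact h ⟨m, hm, h'⟩

end ByName

end Summit.ResolutionOfSingularities.ResolutionOfSingularities.Theorems

end
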